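import Summits.BirchSwinnertonDyer.BirchSwinnertonDyer.Theorems.EisensteinDepletionAtTwoStarOptBSFShimuraExponent
import Mathlib.Data.Nat.GCD.BigOperators
import Mathlib.Data.Nat.Squarefree
import HarnessLib

/-!
# Line `star` on crux E1M (stmt-BirchSwinnertonDyer-20341), even-index residue: the Shimura-exponent door at EVERY squarefree level whose
# prime factors are all `≡ 3 (mod 4)`, and (T2) there as a corollary of (T1)

Lead star-p1 GEN 16, sequel to `…StarOptBSFShimuraExponent` (p701367).
* `units_zmod_listProd_pow_eq_one` — CRT + Fermat over a list of distinct primes: `u^e = 1` for every unit `u` of `ℤ/(∏ p)` as soon as `p − 1 ∣ e`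
  for all `p` in the list; `units_zmod_pow_eq_one_of_squarefree` — the same for squarefree `N` and its prime factors.
* `exists_odd_two_mul_nsmul_mem_periodLatticeGamma1_of_squarefree` — squarefree `N` with every prime factor `≡ 3 (mod 4)`: `2d·Λ_f ⊆ Λ₁(f)` with
  `d = ∏ (p−1)/2` odd (the Shimura exponent has 2-part ≤ 2).
* `starOptBSF_threeModFour_of_T1` — THE DOOR at such levels: prints + (T1) ⇒ the stub's conclusion.
* `optimalNotMidPointed_of_shimuraExpTwo_of_T1` — GEN 15's (T2) «no formal-and-odd rational abscissa on `W₀`» ITSELF follows from the door (an odd étale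
  and an odd formal abscissa would coincide).
CONDITIONAL on the prints and (T1); no `sorry`, no new definition; nothing here reads `r_an`; StarOptB / E1M / BSD are NOT proved by this file.
-/

set_option linter.dupNamespace false
set_option autoImplicit false

noncomputable section

open scoped Classical
open WeierstrassCurve Literature.NumberTheory.EllipticCurves Literature.NumberTheory.EllipticCurves.Greenberg1999
open Literature.NumberTheory.EllipticCurves.ModularForms
open Summit.BirchSwinnertonDyer.BirchSwinnertonDyer.Theorems.DepletionAtTwo

namespace Summit.BirchSwinnertonDyer.BirchSwinnertonDyer.Theorems.DepletionAtTwo.SfShimuraExp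

/-! ### CRT over a list of distinct primes -/

/-- For a list `l` of pairwise distinct primes and `e` with `p − 1 ∣ e` for all `p ∈ l`, every unit `u` of `ℤ/(∏ l)` has `u^e = 1`
(induction: `ℤ/(p·M) ≃ ℤ/p × ℤ/M`, Fermat in the first factor). [folklore] -/
theorem units_zmod_listProd_pow_eq_one :
    ∀ (l : List ℕ) (M : ℕ), l.prod = M → (∀ p ∈ l, p.Prime) → l.Nodup → ∀ {e : ℕ}, (∀ p ∈ l, p - 1 ∣ e) →
      ∀ u : (ZMod M)ˣ, u ^ e = 1 := by
  intro l
  induction l with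
  | nil =>
    intro M hM _ _ e _ u
    rw [List.prod_nil] at hM
    subst hM
    exact Units.ext (Subsingleton.elim _ _)
  | cons p l ih =>
    intro M hM hprime hnodup e hdvd u
    rw [List.prod_cons] at hM
    subst hM
    have hp : p.Prime := hprime p (by simp)
    haveI : Fact p.Prime := ⟨hp⟩
    have hl : ∀ q ∈ l, q.Prime := fun q hq ↦ hprime q (by simp [hq])
    have hnd : l.Nodup := (List.nodup_cons.mp hnodup).2
    have hpl : p ∉ l := (List.nodup_cons.mp hnodup).1
    -- `p` is coprime to `∏ l`
    have hcop : Nat.Coprime p l.prod := by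
      rw [Nat.coprime_list_prod_right_iff]
      intro q hq
      exact (Nat.coprime_primes hp (hl q hq)).mpr (fun h ↦ hpl (h ▸ hq))
    let f : ZMod (p * l.prod) ≃+* ZMod p × ZMod l.prod := ZMod.chineseRemainder hcop
    have hu : IsUnit (u : ZMod (p * l.prod)) := u.isUnit
    have hu1 : IsUnit ((f (u : ZMod (p * l.prod))).1) := (hu.map f).map (RingHom.fst _ _)
    have hu2 : IsUnit ((f (u : ZMod (p * l.prod))).2) := (hu.map f).map (RingHom.snd _ _)
    have h1 : (f (u : ZMod (p * l.prod))).1 ^ e = 1 := by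
      obtain ⟨k, hk⟩ := hdvd p (by simp)
      rw [hk, pow_mul, ZMod.pow_card_sub_one_eq_one hu1.ne_zero, one_pow]
    have h2 : (f (u : ZMod (p * l.prod))).2 ^ e = 1 := by
      obtain ⟨v, hv⟩ := hu2
      have := ih l.prod rfl hl hnd (e := e) (fun q hq ↦ hdvd q (by simp [hq])) v
      rw [← hv, ← Units.val_pow_eq_pow_val, this, Units.val_one]
    have h12 : f ((u : ZMod (p * l.prod)) ^ e) = 1 := by
      rw [map_pow]
      ext
      · rw [Prod.pow_fst, h1]; rfl
      · rw [Prod.pow_snd, h2]; rfl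
    have h : (u : ZMod (p * l.prod)) ^ e = 1 := by
      have := congrArg f.symm h12
      rwa [RingEquiv.symm_apply_apply, map_one] at this
    exact Units.ext (by rw [Units.val_pow_eq_pow_val, h, Units.val_one])

/-- Squarefree `N`, `e` with `p − 1 ∣ e` for every prime `p ∣ N`: every unit `u` of `ℤ/N` has `u^e = 1` (`N = ∏ primeFactorsList N`, the list being
without repetition exactly when `N` is squarefree). [folklore] -/
theorem units_zmod_pow_eq_one_of_squarefree {N : ℕ} (hN : Squarefree N) {e : ℕ} (hdvd : ∀ p, p.Prime → p ∣ N → p - 1 ∣ e)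
    (u : (ZMod N)ˣ) : u ^ e = 1 := by
  have hN0 : N ≠ 0 := hN.ne_zero
  have hprod : N = N.primeFactorsList.prod := (Nat.prod_primeFactorsList hN0).symm
  let g : ZMod N ≃+* ZMod N.primeFactorsList.prod := ZMod.ringEquivCongr hprod
  have hl : ∀ p ∈ N.primeFactorsList, p.Prime := fun p hp ↦ Nat.prime_of_mem_primeFactorsList hp
  have hnd : N.primeFactorsList.Nodup := (Nat.squarefree_iff_nodup_primeFactorsList hN0).mp hN
  have hdvd' : ∀ p ∈ N.primeFactorsList, p - 1 ∣ e := fun p hp ↦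
    hdvd p (hl p hp) (Nat.dvd_of_mem_primeFactorsList hp)
  have hu' : IsUnit (g (u : ZMod N)) := u.isUnit.map g
  obtain ⟨v, hv⟩ := hu'
  have hv1 := units_zmod_listProd_pow_eq_one N.primeFactorsList _ rfl hl hnd hdvd' v
  have h : g ((u : ZMod N) ^ e) = 1 := by
    rw [map_pow, ← hv, ← Units.val_pow_eq_pow_val, hv1, Units.val_one]
  have h' : (u : ZMod N) ^ e = 1 := by
    have := congrArg g.symm h
    rwa [RingEquiv.symm_apply_apply, map_one] at this
  exact Units.ext (by rw [Units.val_pow_eq_pow_val, h', Units.val_one])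

/-- The product of `(p − 1)/2` over a list of primes `≡ 3 (mod 4)` is odd, and `p − 1` divides twice it for each member. [folklore] -/
theorem odd_prod_halves (l : List ℕ) (h3 : ∀ p ∈ l, p % 4 = 3) :
    Odd (l.map fun p ↦ (p - 1) / 2).prod ∧ ∀ p ∈ l, p - 1 ∣ 2 * (l.map fun p ↦ (p - 1) / 2).prod := by
  induction l with
  | nil => simp
  | cons p l ih =>
    have hp : p % 4 = 3 := h3 p (by simp)
    obtain ⟨hodd, hdv⟩ := ih (fun q hq ↦ h3 q (by simp [hq]))
    have hp1 : p - 1 = 2 * ((p - 1) / 2) := by omega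
    have hpo : Odd ((p - 1) / 2) := by rw [Nat.odd_iff]; omega
    refine ⟨?_, ?_⟩
    · rw [List.map_cons, List.prod_cons]
      exact hpo.mul hodd
    · intro q hq
      rw [List.map_cons, List.prod_cons]
      rcases List.mem_cons.mp hq with rfl | hq'
      · refine ⟨(l.map fun p ↦ (p - 1) / 2).prod, ?_⟩
        conv_rhs => rw [hp1]
        ring
      · obtain ⟨k, hk⟩ := hdv q hq'
        refine ⟨(p - 1) / 2 * k, ?_⟩
        calc 2 * ((p - 1) / 2 * (l.map fun p ↦ (p - 1) / 2).prod)
            = (p - 1) / 2 * (2 * (l.map fun p ↦ (p - 1) / 2).prod) := by ring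
          _ = (p - 1) / 2 * ((q - 1) * k) := by rw [hk]
          _ = (q - 1) * ((p - 1) / 2 * k) := by ring

/-- **Squarefree `N` with every prime factor `≡ 3 (mod 4)`: the Shimura exponent is `2 × odd`** — there is an odd `d` (namely `∏_{p∣N} (p−1)/2`) with
`2d·Λ_f ⊆ Λ₁(f)` for every `f ∈ S₂(Γ₀(N))`. [cite: Watkins2002, Lemma 3.1] -/
theorem exists_odd_two_mul_nsmul_mem_periodLatticeGamma1_of_squarefree {N : ℕ} [NeZero N] (hN : Squarefree N)
    (h3 : ∀ p, p.Prime → p ∣ N → p % 4 = 3) (f : CuspForm (CongruenceSubgroup.Gamma0 N) 2) :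
    ∃ d : ℕ, Odd d ∧ ∀ w ∈ periodLattice f, ((2 * d : ℕ) : ℂ) * w ∈ periodLatticeGamma1 f := by
  set l := N.primeFactorsList with hl
  have hl3 : ∀ p ∈ l, p % 4 = 3 := fun p hp ↦
    h3 p (Nat.prime_of_mem_primeFactorsList hp) (Nat.dvd_of_mem_primeFactorsList hp)
  obtain ⟨hodd, hdv⟩ := odd_prod_halves l hl3
  refine ⟨(l.map fun p ↦ (p - 1) / 2).prod, hodd, ?_⟩
  refine ShimuraExp.nsmul_mem_periodLatticeGamma1_of_pow f fun u ↦ units_zmod_pow_eq_one_of_squarefree hN (fun p hp hpN ↦ ?_) u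
  exact hdv p ((Nat.mem_primeFactorsList hN.ne_zero).mpr ⟨hp, hpN⟩)

/-- **THE DOOR at every squarefree level whose prime factors are all `≡ 3 (mod 4)`** (stated with the level `N` of the newform; for a habitat curve
`N = N_W` by `IsNewformOf`): prints + (T1) for the lattice-optimal `W₀` ⇒ `W₀` has an odd étale rational 2-torsion abscissa — (T2) is automatic.
[cite: Watkins2002, Lemma 3.1] [cite: Stevens1989, §2] [cite: GreenbergLNM1716, §5 Props. 5.13–5.14] -/
theorem starOptBSF_threeModFour_of_T1 (hnf : exists_isNewformOf) (hex : exists_optimal_gamma1ParametrizationData)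
    (hU : Literature.NumberTheory.Automorphic.CalegariDimitrovTang2025_unboundedDenominators) {N : ℕ} [NeZero N]
    (hN : Squarefree N) (h3 : ∀ p, p.Prime → p ∣ N → p % 4 = 3) :
    ∀ (W : WeierstrassCurve ℚ) [W.IsElliptic] [W.IsGloballyMinimal] (x : ℚ), IsOrdinaryAt W 2 →
      HasUniqueRationalTwoTorsionX W x →
      ((TwoTorsionRamifiedAtTwo x ∧ ¬ TwoTorsionOdd W x) ∨ (TwoTorsionOdd W x ∧ ¬ TwoTorsionRamifiedAtTwo x)) →
      ∀ (f : CuspForm (CongruenceSubgroup.Gamma0 N) 2), IsNewformOf W f →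
      ∀ (W₀ : WeierstrassCurve ℚ) [W₀.IsElliptic] [W₀.IsGloballyMinimal], IsNewformOf W₀ f →
      ∀ (L₀ : PeriodPair), IsNeronLatticeOf (W₀.baseChange ℂ) L₀ → ∀ (q : ℚ), q ≠ 0 →
      (∀ z ∈ periodLattice f, (q : ℂ) * z ∈ L₀.lattice) → (∀ z ∈ L₀.lattice, ∃ w ∈ periodLattice f, z = (q : ℂ) * w) →
      (∀ x₀ : ℚ, HasUniqueRationalTwoTorsionX W₀ x₀ → TwoTorsionRamifiedAtTwo x₀ → TwoTorsionOdd W₀ x₀) →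
      ∃ x₀ : ℚ, HasRationalTwoTorsionX W₀ x₀ ∧ TwoTorsionOdd W₀ x₀ ∧ ¬ TwoTorsionRamifiedAtTwo x₀ := by
  intro W _ _ x hord hux htype f hW W₀ _ _ hW₀ L₀ hL₀ q hq hin hout hT1
  exact starOptBSF_of_shimuraExpTwo_of_T1 hnf hex hU W x hord hux htype f hW
    (exists_odd_two_mul_nsmul_mem_periodLatticeGamma1_of_squarefree hN h3 f) W₀ hW₀ L₀ hL₀ q hq hin hout hT1

/-- **(T2) from (T1) under the Shimura-exponent hypothesis.**  Prints + «`2d·Λ_f ⊆ Λ₁(f)`, `d` odd» + (T1) for `W₀` ⇒ no rational 2-torsion abscissa of `W₀`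
is BOTH ramified at 2 and odd: the door gives an odd étale abscissa, and two odd abscissas coincide (`Walk.eq_of_twoTorsionOdd_of_twoTorsionOdd`).
[cite: GreenbergLNM1716, §5 Remark (p. 121)] -/
theorem optimalNotMidPointed_of_shimuraExpTwo_of_T1 (hnf : exists_isNewformOf) (hex : exists_optimal_gamma1ParametrizationData)
    (hU : Literature.NumberTheory.Automorphic.CalegariDimitrovTang2025_unboundedDenominators) :
    ∀ (W : WeierstrassCurve ℚ) [W.IsElliptic] [W.IsGloballyMinimal] (x : ℚ), IsOrdinaryAt W 2 →
      HasUniqueRationalTwoTorsionX W x →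
      ((TwoTorsionRamifiedAtTwo x ∧ ¬ TwoTorsionOdd W x) ∨ (TwoTorsionOdd W x ∧ ¬ TwoTorsionRamifiedAtTwo x)) →
      ∀ ⦃N : ℕ⦄ [NeZero N] (f : CuspForm (CongruenceSubgroup.Gamma0 N) 2), IsNewformOf W f →
      (∃ d : ℕ, Odd d ∧ ∀ w ∈ periodLattice f, ((2 * d : ℕ) : ℂ) * w ∈ periodLatticeGamma1 f) →
      ∀ (W₀ : WeierstrassCurve ℚ) [W₀.IsElliptic] [W₀.IsGloballyMinimal], IsNewformOf W₀ f →
      ∀ (L₀ : PeriodPair), IsNeronLatticeOf (W₀.baseChange ℂ) L₀ → ∀ (q : ℚ), q ≠ 0 →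
      (∀ z ∈ periodLattice f, (q : ℂ) * z ∈ L₀.lattice) → (∀ z ∈ L₀.lattice, ∃ w ∈ periodLattice f, z = (q : ℂ) * w) →
      (∀ x₀ : ℚ, HasUniqueRationalTwoTorsionX W₀ x₀ → TwoTorsionRamifiedAtTwo x₀ → TwoTorsionOdd W₀ x₀) →
      ∀ (x₀ : ℚ), HasRationalTwoTorsionX W₀ x₀ → TwoTorsionRamifiedAtTwo x₀ → ¬ TwoTorsionOdd W₀ x₀ := by
  intro W _ _ x hord hux htype N _ f hW hexp W₀ _ _ hW₀ L₀ hL₀ q hq hin hout hT1 x₀ hx₀ hR₀ hO₀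
  obtain ⟨x₁, hx₁, hO₁, hR₁⟩ :=
    starOptBSF_of_shimuraExpTwo_of_T1 hnf hex hU W x hord hux htype f hW hexp W₀ hW₀ L₀ hL₀ q hq hin hout hT1
  have h : x₀ = x₁ := Walk.eq_of_twoTorsionOdd_of_twoTorsionOdd hx₀ hx₁ hO₀ hO₁
  exact hR₁ (h ▸ hR₀)

end Summit.BirchSwinnertonDyer.BirchSwinnertonDyer.Theorems.DepletionAtTwo.SfShimuraExp

end
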